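import Literature.NumberTheory.LFunctions.ZetaOrdinateDictionary
import Literature.NumberTheory.LFunctions.SchoenfeldZeroSumsExplicit
import Literature.NumberTheory.LFunctions.ZetaFirstZeroCertificate
import Literature.NumberTheory.LFunctions.ZetaZeroTailSums
import Literature.Analysis.SpecialFunctions.TanhPartialFractions
import HarnessLib

/-!
# The second moment of the sharp eta vector at the zeros, zero side I: the diagonal of the dual sum
(route EtaLeadingQuarter, item `EtaLeadingSecondMoment`, stmt-RiemannHypothesis-21791)

`γ_n = zetaOrdinate n` are the positive ordinates of the zeros of `ζ` (with multiplicity),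
`N(T) = zetaZeroCount T`. At a zero the sharp eta partial sum is (under RH) minus the tail of the
alternating series, whose dual (stationary-phase) form is `√2·χ·∑_{k odd, kπM ≤ γ} k^{−1/2−iγ}` up to
an error (sibling files `EtaLeadingQuarterSecondMomentAFE*`). Here: the DIAGONAL of the squared dual
sum over the zeros with weight `M/γ²`: `sum_zerosBetween_eq_sum_Ico` (block dictionary
`∑_{T<Im ρ≤U} m(ρ) g(Im ρ) = ∑_{N(T)≤n<N(U)} g(γ_n)`), `sum_filter_inv_sq_le_Gtail`
(`∑_{n<N, γ_n ≥ T} γ_n^{-2} ≤ G(T)`, `T > 2516`, tree `sum_zerosBetween_le_Gtail`), `Gtail_le_log`,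
`diag_partial_le` / `diag_tsum_le` (`M ∑_n γ_n^{-2} ∑_{k odd ≤ γ_n/(πM)} 1/k ≤ (log M)/16 + C₀` for
`M ≥ 801`: swap the sums, tail bound, `∑_{k odd} 1/k² = π²/8`) and `diag_eventually_le`
(`≤ (1/16 + ε) log M` eventually). `1/16` is the one-sided value: with both signs of `γ` and
`|√2 χ|² = 2` it is the `1/4` of `EtaLeadingSecondMoment`. RH-free; nothing here bears on the truth
of RH.
-/

noncomputable section

open Real Finset Filter Topology

set_option linter.dupNamespace false  -- the mandated namespace repeats `RiemannHypothesis`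

namespace Summit.RiemannHypothesis.RiemannHypothesis.Theorems.EtaLeadingQuarter.Zeros

open Literature.NumberTheory.LFunctions SchoenfeldBound

/-- `zerosBetween T U` is the difference of the two counting boxes (as `Finset`s). [folklore] -/
theorem zerosBetween_eq_sdiff {T U : ℝ} (hT : 0 ≤ T) :
    zerosBetween T U = (zetaZeroBox_finite 0 U).toFinset \ (zetaZeroBox_finite 0 T).toFinset := by
  ext ρ
  rw [mem_zerosBetween hT, Finset.mem_sdiff, Set.Finite.mem_toFinset, Set.Finite.mem_toFinset]
  simp only [zetaZeroBox, Set.mem_setOf_eq]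
  constructor
  · rintro ⟨hz, h1, h2, h3, h4⟩
    exact ⟨⟨hz, h1, h2, hT.trans_lt h3, h4⟩, fun h ↦ absurd h.2.2.2.2 (not_le.2 h3)⟩
  · rintro ⟨⟨hz, h1, h2, h3, h4⟩, hn⟩
    refine ⟨hz, h1, h2, ?_, h4⟩
    by_contra hle
    exact hn ⟨hz, h1, h2, h3, not_lt.1 hle⟩

/-- **Block dictionary**: for `0 ≤ T ≤ U` and real `g`,
`∑_{T < Im ρ ≤ U} m(ρ) g(Im ρ) = ∑_{N(T) ≤ n < N(U)} g(γ_n)`. [folklore] -/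
theorem sum_zerosBetween_eq_sum_Ico (g : ℝ → ℝ) {T U : ℝ} (hT : 0 ≤ T) (hTU : T ≤ U) :
    ∑ ρ ∈ zerosBetween T U, (riemannZetaZeroOrder ρ : ℝ) * g ρ.im =
      ∑ n ∈ Finset.Ico (zetaZeroCount T) (zetaZeroCount U), g (zetaOrdinate n) := by
  have hU := OrdinateDictionary.sum_zetaZeroBox_mul_eq_sum_range (fun t ↦ ((g t : ℝ) : ℂ)) U
  have hT' := OrdinateDictionary.sum_zetaZeroBox_mul_eq_sum_range (fun t ↦ ((g t : ℝ) : ℂ)) T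
  have hsub : (zetaZeroBox_finite 0 T).toFinset ⊆ (zetaZeroBox_finite 0 U).toFinset := by
    intro ρ hρ
    rw [Set.Finite.mem_toFinset] at hρ ⊢
    exact ⟨hρ.1, hρ.2.1, hρ.2.2.1, hρ.2.2.2.1, hρ.2.2.2.2.trans hTU⟩
  have hC : ((∑ ρ ∈ zerosBetween T U, (riemannZetaZeroOrder ρ : ℝ) * g ρ.im : ℝ) : ℂ) =
      ((∑ n ∈ Finset.Ico (zetaZeroCount T) (zetaZeroCount U), g (zetaOrdinate n) : ℝ) : ℂ) := by
    push_cast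
    rw [zerosBetween_eq_sdiff hT, Finset.sum_sdiff_eq_sub hsub,
      Finset.sum_Ico_eq_sub _ (zetaZeroCount_mono hTU), hU, hT']
  exact_mod_cast hC

/-- Every ordinate is `> 14`. [folklore] -/
theorem fourteen_lt_zetaOrdinate (n : ℕ) : 14 < zetaOrdinate n :=
  fourteen_lt_zetaOrdinate_zero_holds.trans_le (zetaOrdinate_mono_holds (Nat.zero_le n))

/-- `G` is continuous at every `T > 0`. [folklore] -/
theorem continuousAt_Gtail {T : ℝ} (hT : 0 < T) : ContinuousAt Gtail T := by
  have h1 : ContinuousAt (fun T : ℝ ↦ (Real.log (T / (2 * π)) + 1) / (2 * π) * T⁻¹) T :=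
    ((((continuousAt_id.div_const _).log (by simp; positivity)).add continuousAt_const).div_const _).mul
      (continuousAt_inv₀ hT.ne')
  have h2 : ContinuousAt (fun T : ℝ ↦ (2 * 34.6 + 6.67 / 2 + 2 * 6.67 * Real.log T) * (T ^ 2)⁻¹) T :=
    (continuousAt_const.add (continuousAt_const.mul (continuousAt_log hT.ne'))).mul
      ((continuousAt_pow T 2).inv₀ (by positivity))
  have h3 : ContinuousAt (fun T : ℝ ↦ 5 * 0.3725 / 3 * (T ^ 3)⁻¹) T :=
    continuousAt_const.mul ((continuousAt_pow T 3).inv₀ (by positivity))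
  exact (h1.add h2).add h3

/-- **Tail over the enumeration**: for `T > 2516` and every `N`,
`∑_{n < N, γ_n ≥ T} γ_n^{-2} ≤ G(T)` (the zeros `T' < γ ≤ U` for every `2516 ≤ T' < T` and
`U ≥ γ_N`, by `sum_zerosBetween_le_Gtail`, then `T' → T`). [folklore] -/
theorem sum_filter_inv_sq_le_Gtail {T : ℝ} (hT : 2516 < T) (N : ℕ) :
    ∑ n ∈ (Finset.range N).filter (fun n ↦ T ≤ zetaOrdinate n), 1 / zetaOrdinate n ^ 2 ≤ Gtail T := by
  classical
  set S := ∑ n ∈ (Finset.range N).filter (fun n ↦ T ≤ zetaOrdinate n), 1 / zetaOrdinate n ^ 2 with hS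
  set U : ℝ := max T (zetaOrdinate N) with hU
  -- for every `T' ∈ [2516, T)`: `S ≤ G(T')`
  have hstep : ∀ T' : ℝ, 2516 ≤ T' → T' < T → S ≤ Gtail T' := by
    intro T' h1 h2
    have hT'0 : 0 ≤ T' := by linarith
    have hT'U : T' ≤ U := h2.le.trans (le_max_left _ _)
    have hsub : (Finset.range N).filter (fun n ↦ T ≤ zetaOrdinate n) ⊆
        Finset.Ico (zetaZeroCount T') (zetaZeroCount U) := by
      intro n hn
      rw [Finset.mem_filter, Finset.mem_range] at hn
      rw [Finset.mem_Ico]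
      refine ⟨Montgomery.lt_zetaOrdinate_iff.1 (h2.trans_le hn.2), Montgomery.zetaOrdinate_le_iff_lt.1 ?_⟩
      exact (zetaOrdinate_mono_holds hn.1.le).trans (le_max_right _ _)
    have hblock := sum_zerosBetween_eq_sum_Ico (fun t ↦ (t ^ 2)⁻¹) hT'0 hT'U
    have hG := sum_zerosBetween_le_Gtail h1 hT'U
    rw [hblock] at hG
    calc S ≤ ∑ n ∈ Finset.Ico (zetaZeroCount T') (zetaZeroCount U), (zetaOrdinate n ^ 2)⁻¹ := by
          rw [hS]
          simp_rw [one_div]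
          exact Finset.sum_le_sum_of_subset_of_nonneg hsub fun n _ _ ↦ by positivity
      _ ≤ Gtail T' := hG
  -- let `T' → T⁻`
  have hT0 : 0 < T := by linarith
  have htend : Tendsto Gtail (𝓝[<] T) (𝓝 (Gtail T)) :=
    (continuousAt_Gtail hT0).continuousWithinAt.tendsto
  have hev : ∀ᶠ T' in 𝓝[<] T, S ≤ Gtail T' := by
    have hmem : Set.Ioo 2516 T ∈ 𝓝[<] T := Ioo_mem_nhdsLT hT
    filter_upwards [hmem] with T' hT'
    exact hstep T' hT'.1.le hT'.2
  exact ge_of_tendsto htend hev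

/-- `∑_{k ≤ Y, k odd} 1/k² ≤ π²/8`. [folklore] -/
theorem sum_odd_inv_sq_le (Y : ℕ) :
    ∑ k ∈ (Finset.Icc 1 Y).filter Odd, 1 / (k : ℝ) ^ 2 ≤ π ^ 2 / 8 := by
  classical
  have hsub : (Finset.Icc 1 Y).filter Odd ⊆ (Finset.range Y).image (fun i : ℕ ↦ 2 * i + 1) := by
    intro k hk
    rw [Finset.mem_filter, Finset.mem_Icc] at hk
    obtain ⟨⟨h1, h2⟩, ⟨i, hi⟩⟩ := hk
    rw [Finset.mem_image]
    exact ⟨i, Finset.mem_range.2 (by omega), by omega⟩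
  have hinj : Set.InjOn (fun i : ℕ ↦ 2 * i + 1) (Finset.range Y : Set ℕ) := fun a _ b _ h ↦ by
    simpa using h
  have himg : ∑ k ∈ (Finset.range Y).image (fun i : ℕ ↦ 2 * i + 1), 1 / ((k : ℕ) : ℝ) ^ 2 =
      ∑ i ∈ Finset.range Y, 1 / (2 * (i : ℝ) + 1) ^ 2 := by
    rw [Finset.sum_image hinj]
    refine Finset.sum_congr rfl fun i _ ↦ ?_
    push_cast; ring
  calc ∑ k ∈ (Finset.Icc 1 Y).filter Odd, 1 / (k : ℝ) ^ 2
      ≤ ∑ k ∈ (Finset.range Y).image (fun i : ℕ ↦ 2 * i + 1), 1 / ((k : ℕ) : ℝ) ^ 2 :=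
        Finset.sum_le_sum_of_subset_of_nonneg hsub fun k _ _ ↦ by positivity
    _ = ∑ i ∈ Finset.range Y, 1 / (2 * (i : ℝ) + 1) ^ 2 := himg
    _ ≤ π ^ 2 / 8 :=
        sum_le_hasSum _ (fun i _ ↦ by positivity) Literature.Analysis.SpecialFunctions.hasSum_one_div_odd_sq

/-- `∑_{k ≤ Y, k odd} 1/k³ ≤ π²/8`. [folklore] -/
theorem sum_odd_inv_cube_le (Y : ℕ) :
    ∑ k ∈ (Finset.Icc 1 Y).filter Odd, 1 / (k : ℝ) ^ 3 ≤ π ^ 2 / 8 := by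
  refine le_trans (Finset.sum_le_sum fun k hk ↦ ?_) (sum_odd_inv_sq_le Y)
  rw [Finset.mem_filter, Finset.mem_Icc] at hk
  have hk1 : (1 : ℝ) ≤ k := by exact_mod_cast hk.1.1
  exact one_div_le_one_div_of_le (by positivity) (by nlinarith)

/-- `log k ≤ 2 k^{1/2}` and hence `log k / k² ≤ 2 / k^{3/2}` for `k ≥ 1`. [folklore] -/
theorem log_div_sq_le {k : ℕ} (hk : 1 ≤ k) :
    Real.log k / (k : ℝ) ^ 2 ≤ 2 * (1 / (k : ℝ) ^ (3 / 2 : ℝ)) := by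
  have hk0 : (0 : ℝ) < k := by exact_mod_cast hk
  have hlog : Real.log k ≤ (k : ℝ) ^ (1 / 2 : ℝ) / (1 / 2) :=
    Real.log_le_rpow_div hk0.le (by norm_num)
  have e : (k : ℝ) ^ 2 = (k : ℝ) ^ (1 / 2 : ℝ) * (k : ℝ) ^ (3 / 2 : ℝ) := by
    rw [← Real.rpow_add hk0]; norm_num
  rw [e, div_le_iff₀ (by positivity)]
  have h32 : 0 < (k : ℝ) ^ (3 / 2 : ℝ) := by positivity
  have h12 : 0 < (k : ℝ) ^ (1 / 2 : ℝ) := by positivity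
  calc Real.log k ≤ 2 * (k : ℝ) ^ (1 / 2 : ℝ) := by linarith
    _ = 2 * (1 / (k : ℝ) ^ (3 / 2 : ℝ)) * ((k : ℝ) ^ (1 / 2 : ℝ) * (k : ℝ) ^ (3 / 2 : ℝ)) := by
        field_simp

/-- `∑_{k ≤ Y, k odd} log k / k² ≤ 2 ∑_k k^{-3/2}`. [folklore] -/
theorem sum_odd_log_div_sq_le (Y : ℕ) :
    ∑ k ∈ (Finset.Icc 1 Y).filter Odd, Real.log k / (k : ℝ) ^ 2 ≤
      2 * ∑' k : ℕ, 1 / (k : ℝ) ^ (3 / 2 : ℝ) := by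
  calc ∑ k ∈ (Finset.Icc 1 Y).filter Odd, Real.log k / (k : ℝ) ^ 2
      ≤ ∑ k ∈ (Finset.Icc 1 Y).filter Odd, 2 * (1 / (k : ℝ) ^ (3 / 2 : ℝ)) :=
        Finset.sum_le_sum fun k hk ↦ by
          rw [Finset.mem_filter, Finset.mem_Icc] at hk
          exact log_div_sq_le hk.1.1
    _ = 2 * ∑ k ∈ (Finset.Icc 1 Y).filter Odd, 1 / (k : ℝ) ^ (3 / 2 : ℝ) := by rw [Finset.mul_sum]
    _ ≤ 2 * ∑' k : ℕ, 1 / (k : ℝ) ^ (3 / 2 : ℝ) := by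
        refine mul_le_mul_of_nonneg_left ?_ (by norm_num)
        exact Summable.sum_le_tsum _ (fun k _ ↦ by positivity) (Real.summable_one_div_nat_rpow.2 (by norm_num))

/-- `∑_{k ≤ Y, k odd} log k / k³ ≤ 2 ∑_k k^{-3/2}`. [folklore] -/
theorem sum_odd_log_div_cube_le (Y : ℕ) :
    ∑ k ∈ (Finset.Icc 1 Y).filter Odd, Real.log k / (k : ℝ) ^ 3 ≤
      2 * ∑' k : ℕ, 1 / (k : ℝ) ^ (3 / 2 : ℝ) := by
  refine le_trans (Finset.sum_le_sum fun k hk ↦ ?_) (sum_odd_log_div_sq_le Y)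
  rw [Finset.mem_filter, Finset.mem_Icc] at hk
  have hk1 : (1 : ℝ) ≤ k := by exact_mod_cast hk.1.1
  have hlog : 0 ≤ Real.log k := Real.log_nonneg hk1
  clear hk
  exact div_le_div_of_nonneg_left hlog (by positivity) (by nlinarith)

/-- `G(T) ≤ (log T + 1)/(2πT) + 23 log T/T²` for `T ≥ 2516`. [folklore] -/
theorem Gtail_le_log {T : ℝ} (hT : 2516 ≤ T) :
    Gtail T ≤ (Real.log T + 1) / (2 * π * T) + 23 * Real.log T / T ^ 2 := by
  have hT0 : 0 < T := by linarith
  have hπ := Real.pi_gt_three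
  have hlogT : 7.83 ≤ Real.log T := ZetaZeroTails.log_2516_ge.trans (Real.log_le_log (by norm_num) hT)
  have hlog2π : 0 ≤ Real.log (2 * π) := Real.log_nonneg (by linarith)
  unfold Gtail
  rw [Real.log_div hT0.ne' (by positivity)]
  have h1 : (Real.log T - Real.log (2 * π) + 1) / (2 * π) * T⁻¹ ≤ (Real.log T + 1) / (2 * π * T) := by
    rw [show (Real.log T + 1) / (2 * π * T) = (Real.log T + 1) / (2 * π) * T⁻¹ by
      field_simp]
    exact mul_le_mul_of_nonneg_right (div_le_div_of_nonneg_right (by linarith) (by positivity))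
      (inv_nonneg.2 hT0.le)
  have h2 : (2 * 34.6 + 6.67 / 2 + 2 * 6.67 * Real.log T) * (T ^ 2)⁻¹ ≤ 22.61 * Real.log T / T ^ 2 := by
    rw [div_eq_mul_inv]
    exact mul_le_mul_of_nonneg_right (by nlinarith) (by positivity)
  have h3 : 5 * 0.3725 / 3 * (T ^ 3)⁻¹ ≤ 0.39 * Real.log T / T ^ 2 := by
    rw [div_eq_mul_inv, show (T ^ 3)⁻¹ = T⁻¹ * (T ^ 2)⁻¹ by rw [pow_succ']; rw [mul_inv]]
    rw [← mul_assoc]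
    refine mul_le_mul_of_nonneg_right ?_ (by positivity)
    have : T⁻¹ ≤ 1 := inv_le_one_of_one_le₀ (by linarith)
    nlinarith
  have h4 : 22.61 * Real.log T / T ^ 2 + 0.39 * Real.log T / T ^ 2 = 23 * Real.log T / T ^ 2 := by ring
  linarith

/-- Membership in the dual range: for `M > 0`, `k ≤ ⌊t/(πM)⌋₊ ↔ kπM ≤ t` (`t ≥ 0`, `k ≥ 1`). [folklore] -/
theorem le_floor_iff_mul_le {M : ℕ} (hM : 0 < M) {t : ℝ} (ht : 0 ≤ t) (k : ℕ) :
    k ≤ ⌊t / (π * M)⌋₊ ↔ (k : ℝ) * (π * M) ≤ t := by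
  have hπM : 0 < π * (M : ℝ) := by positivity
  rw [Nat.le_floor_iff (div_nonneg ht hπM.le), le_div_iff₀ hπM]

/-- **The diagonal, partial sums.** For `M ≥ 801` (so that `πM > 2516`) and every `N`:
`M ∑_{n<N} γ_n^{-2} ∑_{k odd ≤ γ_n/(πM)} 1/k ≤ (log M)/16 + C₀`,
`C₀ = (log π + 1)/16 + 47 Z/π² + 23π/8`, `Z = ∑_k k^{-3/2}`. [folklore] -/
theorem diag_partial_le {M : ℕ} (hM : 801 ≤ M) (N : ℕ) :
    (M : ℝ) * ∑ n ∈ Finset.range N,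
        (∑ k ∈ (Finset.Icc 1 ⌊zetaOrdinate n / (π * M)⌋₊).filter Odd, 1 / (k : ℝ)) / zetaOrdinate n ^ 2 ≤
      Real.log M / 16 + ((Real.log π + 1) / 16 + 47 * (∑' k : ℕ, 1 / (k : ℝ) ^ (3 / 2 : ℝ)) / π ^ 2 +
        23 * π / 8) := by
  classical
  set Z : ℝ := ∑' k : ℕ, 1 / (k : ℝ) ^ (3 / 2 : ℝ) with hZ
  have hZ0 : 0 ≤ Z := tsum_nonneg fun k ↦ by positivity
  have hπ := Real.pi_gt_d6
  have hM0 : 0 < M := by omega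
  have hMr : (801 : ℝ) ≤ M := by exact_mod_cast hM
  have hMpos : (0 : ℝ) < M := by positivity
  have hπM : 2516 < π * (M : ℝ) := by nlinarith
  have hπM0 : 0 < π * (M : ℝ) := by positivity
  set L : ℝ := Real.log (π * M) with hL
  have hLeq : L = Real.log π + Real.log M := by rw [hL, Real.log_mul (by positivity) hMpos.ne']
  have hL0 : 0 ≤ L := Real.log_nonneg (by linarith)
  have hLM : L ≤ π * M := by
    have := Real.log_le_sub_one_of_pos hπM0
    rw [hL]; linarith
  -- a common range for the inner sums
  set Y : ℕ := ⌊zetaOrdinate N / (π * M)⌋₊ with hY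
  have hyn : ∀ n ∈ Finset.range N, ⌊zetaOrdinate n / (π * M)⌋₊ ≤ Y := by
    intro n hn
    rw [Finset.mem_range] at hn
    exact Nat.floor_le_floor (div_le_div_of_nonneg_right (zetaOrdinate_mono_holds hn.le) hπM0.le)
  have hγ0 : ∀ n, 0 ≤ zetaOrdinate n := fun n ↦ by linarith [fourteen_lt_zetaOrdinate n]
  -- rewrite the inner sums over the common range with an indicator
  have hinner : ∀ n ∈ Finset.range N,
      (∑ k ∈ (Finset.Icc 1 ⌊zetaOrdinate n / (π * M)⌋₊).filter Odd, 1 / (k : ℝ)) / zetaOrdinate n ^ 2 =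
        ∑ k ∈ (Finset.Icc 1 Y).filter Odd,
          if (k : ℝ) * (π * M) ≤ zetaOrdinate n then 1 / (k : ℝ) * (1 / zetaOrdinate n ^ 2) else 0 := by
    intro n hn
    rw [Finset.sum_div, ← Finset.sum_filter]
    have hset : ((Finset.Icc 1 Y).filter Odd).filter (fun k : ℕ ↦ (k : ℝ) * (π * M) ≤ zetaOrdinate n) =
        (Finset.Icc 1 ⌊zetaOrdinate n / (π * M)⌋₊).filter Odd := by
      ext k
      simp only [Finset.mem_filter, Finset.mem_Icc]
      constructor
      · rintro ⟨⟨⟨h1, -⟩, ho⟩, hle⟩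
        exact ⟨⟨h1, (le_floor_iff_mul_le hM0 (hγ0 n) k).2 hle⟩, ho⟩
      · rintro ⟨⟨h1, h2⟩, ho⟩
        exact ⟨⟨⟨h1, h2.trans (hyn n hn)⟩, ho⟩, (le_floor_iff_mul_le hM0 (hγ0 n) k).1 h2⟩
    rw [hset]
    refine Finset.sum_congr rfl fun k _ ↦ ?_
    field_simp
  rw [Finset.sum_congr rfl hinner, Finset.sum_comm]
  -- the inner sums over `n` are tails `≤ G(kπM)`
  have htail : ∀ k ∈ (Finset.Icc 1 Y).filter Odd,
      ∑ n ∈ Finset.range N, (if (k : ℝ) * (π * M) ≤ zetaOrdinate n then 1 / (k : ℝ) * (1 / zetaOrdinate n ^ 2) else 0)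
        ≤ 1 / (k : ℝ) * Gtail ((k : ℝ) * (π * M)) := by
    intro k hk
    rw [Finset.mem_filter, Finset.mem_Icc] at hk
    have hk1 : (1 : ℝ) ≤ k := by exact_mod_cast hk.1.1
    have hTk : 2516 < (k : ℝ) * (π * M) := by nlinarith
    rw [← Finset.sum_filter, ← Finset.mul_sum]
    exact mul_le_mul_of_nonneg_left (sum_filter_inv_sq_le_Gtail hTk N) (by positivity)
  -- the explicit form of `G`
  have hG : ∀ k ∈ (Finset.Icc 1 Y).filter Odd,
      (M : ℝ) * (1 / (k : ℝ) * Gtail ((k : ℝ) * (π * M))) ≤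
        (Real.log k + L + 1) / (2 * π ^ 2) * (1 / (k : ℝ) ^ 2) +
          23 / π ^ 2 * ((Real.log k + L) / (k : ℝ) ^ 3) * (1 / M) := by
    intro k hk
    rw [Finset.mem_filter, Finset.mem_Icc] at hk
    have hk1 : (1 : ℝ) ≤ k := by exact_mod_cast hk.1.1
    have hk0 : (0 : ℝ) < k := by linarith
    have hTk : 2516 ≤ (k : ℝ) * (π * M) := by nlinarith
    have hlogk : Real.log ((k : ℝ) * (π * M)) = Real.log k + L := by
      rw [Real.log_mul hk0.ne' hπM0.ne', hL]
    have h := Gtail_le_log hTk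
    rw [hlogk] at h
    have hlk0 : 0 ≤ Real.log k + L := add_nonneg (Real.log_nonneg hk1) hL0
    calc (M : ℝ) * (1 / (k : ℝ) * Gtail ((k : ℝ) * (π * M)))
        ≤ (M : ℝ) * (1 / (k : ℝ) * ((Real.log k + L + 1) / (2 * π * ((k : ℝ) * (π * M))) +
            23 * (Real.log k + L) / ((k : ℝ) * (π * M)) ^ 2)) := by
          gcongr
      _ = (Real.log k + L + 1) / (2 * π ^ 2) * (1 / (k : ℝ) ^ 2) +
          23 / π ^ 2 * ((Real.log k + L) / (k : ℝ) ^ 3) * (1 / M) := by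
          field_simp
  -- sum the explicit form
  have hsum1 : ∑ k ∈ (Finset.Icc 1 Y).filter Odd, (Real.log k + L + 1) / (2 * π ^ 2) * (1 / (k : ℝ) ^ 2)
      ≤ (2 * Z + (L + 1) * (π ^ 2 / 8)) / (2 * π ^ 2) := by
    have e : ∀ k ∈ (Finset.Icc 1 Y).filter Odd,
        (Real.log k + L + 1) / (2 * π ^ 2) * (1 / (k : ℝ) ^ 2) =
          (Real.log k / (k : ℝ) ^ 2 + (L + 1) * (1 / (k : ℝ) ^ 2)) / (2 * π ^ 2) := by
      intro k _; ring
    rw [Finset.sum_congr rfl e, ← Finset.sum_div, Finset.sum_add_distrib, ← Finset.mul_sum]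
    refine div_le_div_of_nonneg_right (add_le_add (sum_odd_log_div_sq_le Y) ?_) (by positivity)
    exact mul_le_mul_of_nonneg_left (sum_odd_inv_sq_le Y) (by linarith)
  have hsum2 : ∑ k ∈ (Finset.Icc 1 Y).filter Odd, 23 / π ^ 2 * ((Real.log k + L) / (k : ℝ) ^ 3) * (1 / M)
      ≤ 23 / π ^ 2 * (2 * Z + L * (π ^ 2 / 8)) * (1 / M) := by
    rw [← Finset.sum_mul, ← Finset.mul_sum]
    refine mul_le_mul_of_nonneg_right (mul_le_mul_of_nonneg_left ?_ (by positivity)) (by positivity)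
    have e : ∀ k ∈ (Finset.Icc 1 Y).filter Odd,
        (Real.log k + L) / (k : ℝ) ^ 3 = Real.log k / (k : ℝ) ^ 3 + L * (1 / (k : ℝ) ^ 3) := by
      intro k _; ring
    rw [Finset.sum_congr rfl e, Finset.sum_add_distrib, ← Finset.mul_sum]
    exact add_le_add (sum_odd_log_div_cube_le Y) (mul_le_mul_of_nonneg_left (sum_odd_inv_cube_le Y) hL0)
  -- bookkeeping
  have hLM' : L * (1 / (M : ℝ)) ≤ π := by
    rw [mul_one_div, div_le_iff₀ hMpos]; linarith
  have h1M : 1 / (M : ℝ) ≤ 1 := by rw [div_le_one hMpos]; linarith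
  calc (M : ℝ) * ∑ k ∈ (Finset.Icc 1 Y).filter Odd, ∑ n ∈ Finset.range N,
          (if (k : ℝ) * (π * M) ≤ zetaOrdinate n then 1 / (k : ℝ) * (1 / zetaOrdinate n ^ 2) else 0)
      ≤ (M : ℝ) * ∑ k ∈ (Finset.Icc 1 Y).filter Odd, 1 / (k : ℝ) * Gtail ((k : ℝ) * (π * M)) :=
        mul_le_mul_of_nonneg_left (Finset.sum_le_sum htail) hMpos.le
    _ = ∑ k ∈ (Finset.Icc 1 Y).filter Odd, (M : ℝ) * (1 / (k : ℝ) * Gtail ((k : ℝ) * (π * M))) := by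
        rw [Finset.mul_sum]
    _ ≤ ∑ k ∈ (Finset.Icc 1 Y).filter Odd, ((Real.log k + L + 1) / (2 * π ^ 2) * (1 / (k : ℝ) ^ 2) +
          23 / π ^ 2 * ((Real.log k + L) / (k : ℝ) ^ 3) * (1 / M)) := Finset.sum_le_sum hG
    _ ≤ (2 * Z + (L + 1) * (π ^ 2 / 8)) / (2 * π ^ 2) + 23 / π ^ 2 * (2 * Z + L * (π ^ 2 / 8)) * (1 / M) := by
        rw [Finset.sum_add_distrib]; exact add_le_add hsum1 hsum2
    _ = (L + 1) / 16 + Z / π ^ 2 + 46 * Z / π ^ 2 * (1 / M) + 23 / 8 * (L * (1 / M)) := by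
        field_simp
        ring
    _ ≤ (L + 1) / 16 + Z / π ^ 2 + 46 * Z / π ^ 2 * 1 + 23 / 8 * π := by
        gcongr
    _ = Real.log M / 16 + ((Real.log π + 1) / 16 + 47 * Z / π ^ 2 + 23 * π / 8) := by
        rw [hLeq]; ring

/-- **The diagonal, series form.** For `M ≥ 801` the series `∑_n γ_n^{-2} ∑_{k odd ≤ γ_n/(πM)} 1/k`
converges and `M` times its sum is `≤ (log M)/16 + C₀`. [folklore] -/
theorem diag_tsum_le {M : ℕ} (hM : 801 ≤ M) :
    Summable (fun n : ℕ ↦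
        (∑ k ∈ (Finset.Icc 1 ⌊zetaOrdinate n / (π * M)⌋₊).filter Odd, 1 / (k : ℝ)) / zetaOrdinate n ^ 2) ∧
      (M : ℝ) * ∑' n : ℕ,
          (∑ k ∈ (Finset.Icc 1 ⌊zetaOrdinate n / (π * M)⌋₊).filter Odd, 1 / (k : ℝ)) / zetaOrdinate n ^ 2 ≤
        Real.log M / 16 + ((Real.log π + 1) / 16 + 47 * (∑' k : ℕ, 1 / (k : ℝ) ^ (3 / 2 : ℝ)) / π ^ 2 +
          23 * π / 8) := by
  set C : ℝ := Real.log M / 16 + ((Real.log π + 1) / 16 +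
    47 * (∑' k : ℕ, 1 / (k : ℝ) ^ (3 / 2 : ℝ)) / π ^ 2 + 23 * π / 8) with hC
  have hMpos : (0 : ℝ) < M := by
    have : (801 : ℝ) ≤ M := by exact_mod_cast hM
    linarith
  have hnn : ∀ n : ℕ, 0 ≤
      (∑ k ∈ (Finset.Icc 1 ⌊zetaOrdinate n / (π * M)⌋₊).filter Odd, 1 / (k : ℝ)) / zetaOrdinate n ^ 2 :=
    fun n ↦ div_nonneg (Finset.sum_nonneg fun k _ ↦ by positivity) (sq_nonneg _)
  have hpart : ∀ N : ℕ, ∑ n ∈ Finset.range N,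
      (∑ k ∈ (Finset.Icc 1 ⌊zetaOrdinate n / (π * M)⌋₊).filter Odd, 1 / (k : ℝ)) / zetaOrdinate n ^ 2 ≤
        C / M := by
    intro N
    rw [le_div_iff₀ hMpos, mul_comm]
    exact diag_partial_le hM N
  refine ⟨summable_of_sum_range_le hnn hpart, ?_⟩
  have h := Real.tsum_le_of_sum_range_le hnn hpart
  rwa [le_div_iff₀ hMpos, mul_comm] at h

/-- **The diagonal, leading order.** For every `ε > 0`, for all large `M`,
`M ∑_n γ_n^{-2} ∑_{k odd ≤ γ_n/(πM)} 1/k ≤ (1/16 + ε) log M` (one sign of `γ`; with both signs and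
the factor `|√2 χ|² = 2` of the dual sum this is the `(1/4 + ε) log M` of `EtaLeadingSecondMoment`).
[folklore] -/
theorem diag_eventually_le {ε : ℝ} (hε : 0 < ε) :
    ∀ᶠ M : ℕ in atTop, (M : ℝ) * ∑' n : ℕ,
        (∑ k ∈ (Finset.Icc 1 ⌊zetaOrdinate n / (π * M)⌋₊).filter Odd, 1 / (k : ℝ)) / zetaOrdinate n ^ 2 ≤
      (1 / 16 + ε) * Real.log M := by
  set C₀ : ℝ := (Real.log π + 1) / 16 + 47 * (∑' k : ℕ, 1 / (k : ℝ) ^ (3 / 2 : ℝ)) / π ^ 2 +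
    23 * π / 8 with hC₀
  have hlim : Tendsto (fun M : ℕ ↦ Real.log (M : ℝ)) atTop atTop :=
    Real.tendsto_log_atTop.comp tendsto_natCast_atTop_atTop
  filter_upwards [eventually_ge_atTop 801, hlim.eventually_ge_atTop (C₀ / ε)] with M hM hlog
  have h := (diag_tsum_le hM).2
  have hC : C₀ ≤ ε * Real.log M := by rwa [div_le_iff₀ hε, mul_comm] at hlog
  linarith

end Summit.RiemannHypothesis.RiemannHypothesis.Theorems.EtaLeadingQuarter.Zeros

end
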